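import Summits.ValiantsHypothesis.ValiantsHypothesis.Theorems.DefinabilityGapSparseSubfamily
import Summits.ValiantsHypothesis.ValiantsHypothesis.Theorems.DefinabilityGapBlockIndependence
import HarnessLib

/-!
# Definability gap, ROAD P: privately-free cells are independent — the lower tail (N1 v2 (c))

Step (c) of the existence proof of pivot certificates (NODE-v7 §H / PLAN-N1-v2) on a crowded line:
cells `j ∈ J` with killer sets `K j` (coordinates of the product space `β → Γ`, law `prodWeight w`),
killer `b` ACTIVE at `j` under the assignment `r` iff `r b = τ j`.  The privately-free indicator
`gPF K τ J r j = ∏_{b ∈ priv K J j} [r b ≠ τ j]` depends only on the PRIVATE block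
`priv K J j = K j ∖ shared K J`; these blocks are pairwise disjoint
(`DefinabilityGapSparseSubfamily.disjoint_private`), so by
`DefinabilityGapBlockIndependence.weight_blockSum_le_exp`:

* `sum_prodWeight_mul_coord` — single-coordinate marginal `E[f(r b)] = Σ_a w_b(a) f(a)`;
* `sum_prodWeight_mul_gPF` — `E[gPF_j] = ∏_{b ∈ priv j} (1 − w_b(τ j))`;
* `weight_fewPrivFree_le` — if every `E[gPF_j] ≥ θ ≥ 0` then
  `W{Σ_{j ∈ J} gPF_j ≤ θ·#J/2} ≤ exp(−θ·#J/8)`;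
* `sum_gPF_eq_card` — `Σ_{j ∈ J} gPF_j(r) = #{j ∈ J | privFree}` for the activity predicate
  `fun j b => r b = τ j`, connecting with `card_privFree_le`.
-/

namespace Summit.ValiantsHypothesis.ValiantsHypothesis.Theorems.DefinabilityGapPrivateFree

open Finset Real Literature.Probability.Moments
open Summit.ValiantsHypothesis.ValiantsHypothesis.Theorems.DefinabilityGapSparseSubfamily
open Summit.ValiantsHypothesis.ValiantsHypothesis.Theorems.DefinabilityGapBlockIndependence

variable {α β Γ : Type*}

/- The ACTIVITY PREDICATE of an assignment `r` is written inline as `fun j b => r b = τ j`: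
killer `b` is active at cell `j` iff `r b = τ j` (the co-curve `b` pivots in the row of the
cell). -/

/-- The PRIVATE killers of cell `j` within `J`: its killers not shared with another cell of `J`.
[lens-5 g7] -/
def priv [DecidableEq α] [DecidableEq β] (K : α → Finset β) (J : Finset α) (j : α) : Finset β :=
  (K j).filter fun b => b ∉ shared K J

/-- Membership in `priv`. -/
theorem mem_priv [DecidableEq α] [DecidableEq β] {K : α → Finset β} {J : Finset α} {j : α}
    {b : β} : b ∈ priv K J j ↔ b ∈ K j ∧ b ∉ shared K J := Finset.mem_filter

/-- The private blocks of distinct cells of `J` are disjoint. [lens-5 g7] -/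
theorem disjoint_priv [DecidableEq α] [DecidableEq β] (K : α → Finset β) {J : Finset α}
    {j j' : α} (hj : j ∈ J) (hj' : j' ∈ J) (hne : j ≠ j') :
    Disjoint (priv K J j) (priv K J j') := by
  unfold priv
  exact disjoint_private K hj hj' hne

/-- The privately-free indicator `∏_{b ∈ priv K J j} [r b ≠ τ j]`. [lens-5 g7] -/
def gPF [DecidableEq α] [DecidableEq β] [DecidableEq Γ] (K : α → Finset β) (τ : α → Γ)
    (J : Finset α) (r : β → Γ) (j : α) : ℝ :=
  ∏ b ∈ priv K J j, (if r b ≠ τ j then (1 : ℝ) else 0)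

section Indicator

variable [DecidableEq α] [DecidableEq β] [DecidableEq Γ] (K : α → Finset β) (τ : α → Γ)
  (J : Finset α)

/-- `gPF` as a single indicator. [lens-5 g7] -/
theorem gPF_eq_ite (r : β → Γ) (j : α) :
    gPF K τ J r j = if ∀ b ∈ priv K J j, r b ≠ τ j then 1 else 0 := by
  unfold gPF
  rw [Finset.prod_boole]

/-- `0 ≤ gPF`. -/
theorem gPF_nonneg (r : β → Γ) (j : α) : 0 ≤ gPF K τ J r j := by
  rw [gPF_eq_ite]; split_ifs <;> norm_num

/-- `gPF ≤ 1`. -/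
theorem gPF_le_one (r : β → Γ) (j : α) : gPF K τ J r j ≤ 1 := by
  rw [gPF_eq_ite]; split_ifs <;> norm_num

/-- `gPF_j` depends only on the private block of `j`. [lens-5 g7] -/
theorem dependsOn_gPF (j : α) : DependsOn (fun r => gPF K τ J r j) (↑(priv K J j) : Set β) := by
  intro r r' h
  unfold gPF
  refine Finset.prod_congr rfl fun b hb => ?_
  rw [h b (Finset.mem_coe.mpr hb)]

omit [DecidableEq Γ] in
/-- Privately free (for the activity predicate `fun j b => r b = τ j`) iff no private killer is
active.
[lens-5 g7] -/
theorem privFree_iff (r : β → Γ) (j : α) :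
    privFree K (fun j b => r b = τ j) J j ↔ ∀ b ∈ priv K J j, r b ≠ τ j := by
  unfold privFree
  constructor
  · intro h b hb
    exact h b (mem_priv.mp hb).1 (mem_priv.mp hb).2
  · intro h b hbK hbs
    exact h b (mem_priv.mpr ⟨hbK, hbs⟩)

/-- `Σ_{j ∈ J} gPF_j(r) = #{j ∈ J | privately free under r}`. [lens-5 g7] -/
theorem sum_gPF_eq_card (r : β → Γ) [DecidablePred (privFree K (fun j b => r b = τ j) J)] :
    ∑ j ∈ J, gPF K τ J r j = ((J.filter (privFree K (fun j b => r b = τ j) J)).card : ℝ) := by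
  have h : ∀ j ∈ J, gPF K τ J r j = if privFree K (fun j b => r b = τ j) J j then 1 else 0 := by
    intro j _
    rw [gPF_eq_ite]
    by_cases hp : privFree K (fun j b => r b = τ j) J j
    · rw [if_pos hp, if_pos ((privFree_iff K τ J r j).mp hp)]
    · rw [if_neg hp, if_neg (fun h' => hp ((privFree_iff K τ J r j).mpr h'))]
  rw [Finset.sum_congr rfl h, Finset.sum_boole]

end Indicator

/-! ## Expectations under the product law -/

section Product

variable [Fintype β] [DecidableEq β] [Fintype Γ]

/-- **Single-coordinate marginal**: `E[f(r b)] = Σ_a w_b(a) f(a)`. [lens-5 g7] -/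
theorem sum_prodWeight_mul_coord {w : β → Γ → ℝ} (hw1 : ∀ b, ∑ a, w b a = 1) (b : β)
    (f : Γ → ℝ) : ∑ r : β → Γ, prodWeight w r * f (r b) = ∑ a, w b a * f a := by
  rw [sum_prodWeight_mul_eq_sum_resample hw1 b (fun r => f (r b))]
  simp only [Function.update_self]
  rw [← Finset.sum_mul, sum_prodWeight hw1, one_mul]

variable [DecidableEq α] [DecidableEq Γ]

/-- **Mean of the privately-free indicator**: `E[gPF_j] = ∏_{b ∈ priv j} (1 − w_b(τ j))`
(independence of the single coordinates of the private block). [lens-5 g7] -/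
theorem sum_prodWeight_mul_gPF {w : β → Γ → ℝ} (hw1 : ∀ b, ∑ a, w b a = 1)
    (K : α → Finset β) (τ : α → Γ) (J : Finset α) (j : α) :
    ∑ r : β → Γ, prodWeight w r * gPF K τ J r j = ∏ b ∈ priv K J j, (1 - w b (τ j)) := by
  unfold gPF
  rw [sum_prodWeight_mul_prod_of_dependsOn hw1 (priv K J j) (fun b => ({b} : Finset β))
    (fun b _ b' _ hne => Finset.disjoint_singleton.mpr hne)
    (fun b r => if r b ≠ τ j then (1 : ℝ) else 0)
    (fun b _ r r' h => by simp only [h b (by simp)])]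
  refine Finset.prod_congr rfl fun b _ => ?_
  rw [sum_prodWeight_mul_coord hw1 b (fun a => if a ≠ τ j then (1 : ℝ) else 0)]
  have hsplit : ∀ a, w b a * (if a ≠ τ j then (1 : ℝ) else 0) =
      w b a - (if a = τ j then w b a else 0) := by
    intro a
    by_cases ha : a = τ j
    · simp [ha]
    · simp [ha]
  rw [Finset.sum_congr rfl fun a _ => hsplit a, Finset.sum_sub_distrib, hw1,
    Finset.sum_ite_eq' Finset.univ (τ j) (w b)]
  simp

/-- **Lower tail for the number of privately-free cells.**  If every private block keeps its
cell free with probability `≥ θ ≥ 0`, i.e. `θ ≤ ∏_{b ∈ priv j} (1 − w_b(τ j))` for `j ∈ J`, then the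
assignments with `Σ_{j ∈ J} gPF_j ≤ θ·#J/2` weigh at most `exp(−θ·#J/8)`. [lens-5 g7] -/
theorem weight_fewPrivFree_le {w : β → Γ → ℝ} (hw : ∀ b a, 0 ≤ w b a)
    (hw1 : ∀ b, ∑ a, w b a = 1) (K : α → Finset β) (τ : α → Γ) (J : Finset α) {θ : ℝ}
    (hθ0 : 0 ≤ θ) (hθ : ∀ j ∈ J, θ ≤ ∏ b ∈ priv K J j, (1 - w b (τ j))) :
    ∑ r ∈ (Finset.univ : Finset (β → Γ)).filter
        (fun r => ∑ j ∈ J, gPF K τ J r j ≤ θ * J.card / 2), prodWeight w r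
      ≤ exp (-(θ * J.card / 8)) := by
  have h := weight_blockSum_le_exp hw hw1 J (priv K J)
    (fun j hj j' hj' hne => disjoint_priv K hj hj' hne) (fun j r => gPF K τ J r j)
    (fun j _ => dependsOn_gPF K τ J j) (fun j _ r => gPF_nonneg K τ J r j)
    (fun j _ r => gPF_le_one K τ J r j) (show (0 : ℝ) ≤ 1 / 2 by norm_num) (θ * J.card / 2)
  refine h.trans (Real.exp_le_exp.mpr ?_)
  have hμ : θ * J.card ≤ ∑ j ∈ J, ∑ r : β → Γ, prodWeight w r * gPF K τ J r j := by
    calc θ * J.card = ∑ _j ∈ J, θ := by rw [Finset.sum_const, nsmul_eq_mul, mul_comm]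
      _ ≤ _ := Finset.sum_le_sum fun j hj => by
          rw [sum_prodWeight_mul_gPF hw1 K τ J j]; exact hθ j hj
  have he := exp_neg_half_le
  have hs : (0 : ℝ) ≤ θ * J.card := mul_nonneg hθ0 (Nat.cast_nonneg _)
  nlinarith [he, hs, hμ, Real.exp_nonneg (-(1 / 2 : ℝ))]

end Product

end Summit.ValiantsHypothesis.ValiantsHypothesis.Theorems.DefinabilityGapPrivateFree
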